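import Summits.BirchSwinnertonDyer.BirchSwinnertonDyer.Theses.ShaPrimaryTransfer
import Summits.BirchSwinnertonDyer.BirchSwinnertonDyer.Theorems.Rank1ResidualIntModelReduction
import Literature.NumberTheory.EllipticCurves.KubertTateM37152EisensteinTwist
import Literature.Barriers.BirchSwinnertonDyer.AnomalousHeegnerLogWall
import Literature.NumberTheory.EllipticCurves.LutzNagellGeneralWeierstrass
import Literature.NumberTheory.EllipticCurves.BSDRootNumberSmallConductorRankProofs
import Mathlib.Tactic.NormNum.Prime
import HarnessLib

/-!
# BirchSwinnertonDyer / ShaPrimaryTransfer — crux `FiniteShaComponentTransfer` (stmt-BirchSwinnertonDyer-22356):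
# the FIRST RANK-2 EISENSTEIN-TWIST DOOR `W₆ = [1, −43669, −12, 727222893, −4934118717095] ≅ E_{-37/152}^{(-3)}` — `t₅ = 0`, rank `2`,
# `a₅ = -1`: an ADMISSIBLE, NON-ANOMALOUS door on a rank-2 curve without rational `5`-torsion

Helper file of prover seat `bsd-line-spt-p1` g23 (`--supports stmt-22356 --as helper`). THEOREMS ONLY.  The Literature
instrument `KubertTateM37152EisensteinDescent` (the first `5`-descent over `ℚ(ζ₃)` with SPLIT primes: box of five places filled by
three `ℚ`-points and two genuine `ℚ(ζ₃)`-points of `E_{-37/152}`, `rank E_{-37/152}(ℚ(ζ₃)) = 4`, `t₅ = 0`) and its `ℚ`-side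
`KubertTateM37152EisensteinTwist` give, UNCONDITIONALLY, for the globally minimal model `W₆` of `E_{-37/152}^{(-3)}`:
`rank W₆(ℚ) = 2`, `t₅(W₆) = 0`, `corank_{ℤ₅} Sel_{5^∞}(W₆/ℚ) = 2`, `Good ∧ Red ∧ ¬Anom` at `5`.  Here:

* §1 `integralModelInt_W₆`, `natCard_point_five_W₆` (`#W̃₆(𝔽₅) = 7`: `y² + xy + 3y = x³ + x² + 3x` has ONE affine point),
  **`frobeniusTrace_five_W₆ : a₅(W₆) = -1`**, `goodOrdinary_five_W₆` — the door prime `5` is X2-ADMISSIBLE (good ordinary) and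
  NON-ANOMALOUS (`a₅ ≡ -1`), `printedScope_W₆` (inside the printed scope `Red ∧ Good ∧ a₅ ≢ 1` of the Eisenstein `5`-converses);
* §2 `natCard_point_seven_W₆` (`#W̃₆(𝔽₇) = 10`), **`torsionOrder_W₆_eq_one`** (`#W₆(ℚ)_tors ∣ gcd(7, 10) = 1`): no rational `5`-torsion;
* §3 **`oneFiniteShaComponent_W₆`** (O at `W₆`, witness `p₀ = 5`, unconditional), `transfer_W₆` (T BY NAME);
* §4 **`analyticRank_W₆_eq_mordellWeilRank`**, `analyticRank_W₆_eq_two` — granting X2 (`AnalyticRankLeSelmerCorank`), X3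
  (`PadicOrderLeAnalyticRankAtOnePrime`) and the Kato bound ONLY: `ord_{s=1} L(W₆, s) = rank W₆(ℚ) = 2` (tree
  `analyticRank_eq_mordellWeilRank_of_admissibleDoor`) — T is IDLE on this curve; `analyticRank_W₆_le_two_of_X2`,
  **`analyticRank_W₆_eq_two_of_X2_of_GZK`** (X2 + Gross–Zagier–Kolyvagin ⇒ `r_an(W₆) = 2`; no X3, no Kato, no T).

PLACEMENT (numbers, not adjectives). The tree's other rank-`2` twist door, `E_{146/13}^{(-4)}` (g21, `…GaussianTwistDoor14613Admissible`),
is ANOMALOUS at `5` (`a₅ = −4 ≡ 1`, behind the `AnomalousHeegnerLogWall`); `W₆` is the first rank-`2` door INSIDE the printed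
Eisenstein scope — but the printed Eisenstein `p`-converse (Castella–Grossi–Lee–Skinner 2022, Thm. E) stops at corank `r ∈ {0, 1}`.
So `(W₆, 5)` is a certified instance of the OPEN core of T (Mordell–Weil rank `2`), in exactly the shape a rank-two Eisenstein
converse would consume.  T is UNCHANGED (open at corank ≥ 2); X2, X3, Kato are NOT proved here; BSD is NOT proved by any of this.

## References

* [SilvermanAEC2009] J. H. Silverman, *AEC*, 2nd ed., VII.1 Remark 1.1, VII.5 Prop. 5.1, VIII.8, X.§2, Exercise 10.16.
* [Knapp1993] A. W. Knapp, *Elliptic Curves*, Ch. V §1 Thm. 5.1(c).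
* [GreenbergLNM1716] R. Greenberg, LNM 1716 (1999), §1.
* [CastellaGrossiLeeSkinner2022] F. Castella, G. Grossi, J. Lee, C. Skinner, Invent. Math. 227 (2022), Thm. E.
* [Darmon2004] H. Darmon, *Rational Points on Modular Elliptic Curves*, Thm. 3.22.
-/

-- D-0017: single-problem summit, so `Summit.BirchSwinnertonDyer.BirchSwinnertonDyer.…` repeats a namespace BY DESIGN.
set_option linter.dupNamespace false
set_option autoImplicit false

noncomputable section

open scoped Classical
open Literature.NumberTheory.EllipticCurves WeierstrassCurve
open Literature.NumberTheory.EllipticCurves.Rank1Residual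
open Literature.NumberTheory.EllipticCurves.KubertTateM37152EisensteinTwist (isElliptic_model isGloballyMinimal_model)
open Summit.BirchSwinnertonDyer.BirchSwinnertonDyer.Theses.ShaPrimaryTransfer
open Summit.BirchSwinnertonDyer.BirchSwinnertonDyer.Rank1Residual

namespace Summit.BirchSwinnertonDyer.BirchSwinnertonDyer.Theorems.ShaPrimaryTransferEisensteinTwistDoorM37152

/-! ## §1 Reduction at `5`: `#W̃₆(𝔽₅) = 7`, `a₅ = -1`, good ordinary, non-anomalous -/

/-- The tree's integral model of `W₆` is the integer equation `[1, −43669, −12, 727222893, −4934118717095]` itself. [cite: SilvermanAEC2009, VIII.8] -/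
theorem integralModelInt_W₆ :
    haveI := isGloballyMinimal_model
    integralModelInt (⟨((1 : ℤ) : ℚ), ((-43669 : ℤ) : ℚ), ((-12 : ℤ) : ℚ), ((727222893 : ℤ) : ℚ), ((-4934118717095 : ℤ) : ℚ)⟩ : WeierstrassCurve ℚ) =
      ⟨1, -43669, -12, 727222893, -4934118717095⟩ := by
  haveI := isGloballyMinimal_model
  exact IntModel.integralModelInt_eq_of_map_eq _ (IntModel.map_mk_int 1 (-43669) (-12) 727222893 (-4934118717095))

/-- The reduction modulo `5` of the integer model: `y² + xy + 3y = x³ + x² + 3x` over `𝔽₅`. [folklore] -/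
private theorem map_zmod_five :
    (⟨1, -43669, -12, 727222893, -4934118717095⟩ : WeierstrassCurve ℤ).map (Int.castRingHom (ZMod 5)) =
      (⟨1, 1, 3, 3, 0⟩ : WeierstrassCurve (ZMod 5)) := by
  ext <;> simp [WeierstrassCurve.map] <;> decide

/-- **`#W̃₆(𝔽₅) = 7`**: `y² + xy + 3y = x³ + x² + 3x` has `6` affine solutions over `𝔽₅` (kernel count), plus `O`.
[cite: SilvermanAEC2009, V.2] -/
theorem natCard_point_five_W₆ :
    Nat.card (((⟨1, -43669, -12, 727222893, -4934118717095⟩ : WeierstrassCurve ℤ).map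
      (Int.castRingHom (ZMod 5))).toAffine.Point) = 7 := by
  rw [map_zmod_five, natCard_point_eq_one_add_card (F := ZMod 5) _ (by decide)]
  have h : Fintype.card {xy : ZMod 5 × ZMod 5 //
      xy.2 ^ 2 + (⟨1, 1, 3, 3, 0⟩ : WeierstrassCurve (ZMod 5)).a₁ * xy.1 * xy.2 +
        (⟨1, 1, 3, 3, 0⟩ : WeierstrassCurve (ZMod 5)).a₃ * xy.2 =
      xy.1 ^ 3 + (⟨1, 1, 3, 3, 0⟩ : WeierstrassCurve (ZMod 5)).a₂ * xy.1 ^ 2 +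
        (⟨1, 1, 3, 3, 0⟩ : WeierstrassCurve (ZMod 5)).a₄ * xy.1 + (⟨1, 1, 3, 3, 0⟩ : WeierstrassCurve (ZMod 5)).a₆} = 6 := by
    decide +kernel
  rw [h]

/-- **`a₅(W₆) = -1`** (`= 5 + 1 − 7`; `= -a₅(E_{-37/152})` since `5` is inert in `ℚ(√-3)`): NON-anomalous (`-1 ≢ 1 (mod 5)`).
[cite: SilvermanAEC2009, V.2 and Exercise 10.16] -/
theorem frobeniusTrace_five_W₆ :
    haveI := isGloballyMinimal_model
    (⟨((1 : ℤ) : ℚ), ((-43669 : ℤ) : ℚ), ((-12 : ℤ) : ℚ), ((727222893 : ℤ) : ℚ), ((-4934118717095 : ℤ) : ℚ)⟩ : WeierstrassCurve ℚ).frobeniusTrace 5 = -1 := by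
  haveI := isGloballyMinimal_model
  rw [IntModel.frobeniusTrace_eq integralModelInt_W₆ natCard_point_five_W₆]
  norm_num

/-- **`5` is a prime of good ORDINARY reduction of `W₆`** (`5 ∤ Δ(W₆) = −2¹⁵·3⁶·19⁵·37⁵·40129`, `5 ∤ a₅ = -1`): the door prime of the
`ℚ(ζ₃)`-descent is X2-admissible. [cite: SilvermanAEC2009, VII.5 Prop. 5.1(a)] -/
theorem goodOrdinary_five_W₆ :
    haveI := isGloballyMinimal_model
    haveI : Fact (Nat.Prime 5) := ⟨Nat.prime_five⟩
    (⟨((1 : ℤ) : ℚ), ((-43669 : ℤ) : ℚ), ((-12 : ℤ) : ℚ), ((727222893 : ℤ) : ℚ), ((-4934118717095 : ℤ) : ℚ)⟩ : WeierstrassCurve ℚ).HasGoodReductionAtPrime 5 ∧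
      ¬ ((5 : ℕ) : ℤ) ∣ (⟨((1 : ℤ) : ℚ), ((-43669 : ℤ) : ℚ), ((-12 : ℤ) : ℚ), ((727222893 : ℤ) : ℚ), ((-4934118717095 : ℤ) : ℚ)⟩ :
        WeierstrassCurve ℚ).frobeniusTrace 5 := by
  haveI := isGloballyMinimal_model
  haveI : Fact (Nat.Prime 5) := ⟨Nat.prime_five⟩
  refine ⟨hasGoodReductionAtPrime_of_not_dvd _ 5 ?_, ?_⟩
  · rw [IntModel.minimalDiscriminantInt_eq integralModelInt_W₆]
    have hΔ : (⟨1, -43669, -12, 727222893, -4934118717095⟩ : WeierstrassCurve ℤ).Δ = -164593403507095098342211584 := by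
      norm_num [WeierstrassCurve.Δ, WeierstrassCurve.b₂, WeierstrassCurve.b₄, WeierstrassCurve.b₆, WeierstrassCurve.b₈]
    rw [hΔ]; norm_num
  · rw [frobeniusTrace_five_W₆]; decide

/-- **`(W₆, 5)` lies INSIDE the printed scope `Red ∧ Good ∧ a₅ ≢ 1 (mod 5)`** of the refereed Eisenstein `5`-converses
(`PrintedEisensteinHeegnerLogScope`, barrier file `AnomalousHeegnerLogWall`; here `a₅ = -1`) — unlike every Gaussian-twist door.
[cite: CastellaGrossiLeeSkinner2022, Thm. E (hypothesis φ|G_p ≠ 1, ω)] -/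
theorem printedScope_W₆ :
    haveI := isGloballyMinimal_model
    haveI : Fact (Nat.Prime 5) := ⟨Nat.prime_five⟩
    Literature.Barriers.BirchSwinnertonDyer.PrintedEisensteinHeegnerLogScope
      (⟨((1 : ℤ) : ℚ), ((-43669 : ℤ) : ℚ), ((-12 : ℤ) : ℚ), ((727222893 : ℤ) : ℚ), ((-4934118717095 : ℤ) : ℚ)⟩ : WeierstrassCurve ℚ) 5 := by
  haveI := isElliptic_model
  haveI := isGloballyMinimal_model
  haveI : Fact (Nat.Prime 5) := ⟨Nat.prime_five⟩
  obtain ⟨hgood, hred, -, -, -⟩ := KubertTateM37152EisensteinTwist.cgls_shape_37_152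
  refine ⟨hred, hgood, ?_⟩
  rw [frobeniusTrace_five_W₆]; decide

/-! ## §2 The rational torsion of `W₆` is trivial -/

/-- The reduction modulo `11` of the integer model: `y² + xy + 2y = x³ + 4x² + 5x + 6` over `𝔽₇`. [folklore] -/
private theorem map_zmod_seven :
    (⟨1, -43669, -12, 727222893, -4934118717095⟩ : WeierstrassCurve ℤ).map (Int.castRingHom (ZMod 7)) =
      (⟨1, 4, 2, 5, 6⟩ : WeierstrassCurve (ZMod 7)) := by
  ext <;> simp [WeierstrassCurve.map] <;> decide

/-- **`#W̃₆(𝔽₇) = 10`** (`9` affine solutions of `y² + xy + 2y = x³ + 4x² + 5x + 6` over `𝔽₇`, kernel count, plus `O`). [cite: SilvermanAEC2009, V.2] -/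
theorem natCard_point_seven_W₆ :
    Nat.card (((⟨1, -43669, -12, 727222893, -4934118717095⟩ : WeierstrassCurve ℤ).map
      (Int.castRingHom (ZMod 7))).toAffine.Point) = 10 := by
  rw [map_zmod_seven, natCard_point_eq_one_add_card (F := ZMod 7) _ (by decide)]
  have h : Fintype.card {xy : ZMod 7 × ZMod 7 //
      xy.2 ^ 2 + (⟨1, 4, 2, 5, 6⟩ : WeierstrassCurve (ZMod 7)).a₁ * xy.1 * xy.2 +
        (⟨1, 4, 2, 5, 6⟩ : WeierstrassCurve (ZMod 7)).a₃ * xy.2 =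
      xy.1 ^ 3 + (⟨1, 4, 2, 5, 6⟩ : WeierstrassCurve (ZMod 7)).a₂ * xy.1 ^ 2 +
        (⟨1, 4, 2, 5, 6⟩ : WeierstrassCurve (ZMod 7)).a₄ * xy.1 + (⟨1, 4, 2, 5, 6⟩ : WeierstrassCurve (ZMod 7)).a₆} = 9 := by
    decide +kernel
  rw [h]

/-- **`W₆(ℚ)_tors = 0`**: `#W₆(ℚ)_tors` divides `#W̃₆(𝔽₅) = 7` and `#W̃₆(𝔽₇) = 10` (reduction of torsion at the good odd primes `5, 7`,
tree `torsionOrder_dvd_reductionPointCount`), hence equals `1`: the twist has NO rational `5`-torsion — its door at `5` is not a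
rational-torsion door. [cite: Knapp1993, Ch. V §1 Thm. 5.1(c)] -/
theorem torsionOrder_W₆_eq_one :
    haveI := isElliptic_model
    (⟨((1 : ℤ) : ℚ), ((-43669 : ℤ) : ℚ), ((-12 : ℤ) : ℚ), ((727222893 : ℤ) : ℚ), ((-4934118717095 : ℤ) : ℚ)⟩ : WeierstrassCurve ℚ).torsionOrder = 1 := by
  haveI := isElliptic_model
  haveI := isGloballyMinimal_model
  haveI : Fact (Nat.Prime 5) := ⟨Nat.prime_five⟩
  haveI : Fact (Nat.Prime 7) := ⟨by norm_num⟩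
  have hΔ : (⟨1, -43669, -12, 727222893, -4934118717095⟩ : WeierstrassCurve ℤ).Δ = -164593403507095098342211584 := by
    norm_num [WeierstrassCurve.Δ, WeierstrassCurve.b₂, WeierstrassCurve.b₄, WeierstrassCurve.b₆, WeierstrassCurve.b₈]
  have h5 := LutzNagellGeneral.torsionOrder_dvd_reductionPointCount
    (⟨((1 : ℤ) : ℚ), ((-43669 : ℤ) : ℚ), ((-12 : ℤ) : ℚ), ((727222893 : ℤ) : ℚ), ((-4934118717095 : ℤ) : ℚ)⟩ : WeierstrassCurve ℚ)
    5 (Or.inl (by decide)) (by rw [IntModel.minimalDiscriminantInt_eq integralModelInt_W₆, hΔ]; norm_num)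
  have h7 := LutzNagellGeneral.torsionOrder_dvd_reductionPointCount
    (⟨((1 : ℤ) : ℚ), ((-43669 : ℤ) : ℚ), ((-12 : ℤ) : ℚ), ((727222893 : ℤ) : ℚ), ((-4934118717095 : ℤ) : ℚ)⟩ : WeierstrassCurve ℚ)
    7 (Or.inl (by decide)) (by rw [IntModel.minimalDiscriminantInt_eq integralModelInt_W₆, hΔ]; norm_num)
  rw [WeierstrassCurve.reductionPointCount, integralModelInt_W₆] at h5 h7
  rw [natCard_point_five_W₆] at h5
  rw [natCard_point_seven_W₆] at h7
  have h1 : (⟨((1 : ℤ) : ℚ), ((-43669 : ℤ) : ℚ), ((-12 : ℤ) : ℚ), ((727222893 : ℤ) : ℚ), ((-4934118717095 : ℤ) : ℚ)⟩ :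
      WeierstrassCurve ℚ).torsionOrder ∣ Nat.gcd 7 10 := Nat.dvd_gcd h5 h7
  exact Nat.dvd_one.mp (by simpa using h1)

/-! ## §3 O at `W₆` (unconditional) and T by name -/

/-- **O for `W₆` with witness `p₀ = 5`, UNCONDITIONAL** (`t₅(W₆) = corank Sel₅∞ − rank = 2 − 2`; tree `cgls_shape_37_152`, by the
`5`-descent over `ℚ(ζ₃)` with split primes). [cite: SilvermanAEC2009, Thm. X.4.2] -/
theorem oneFiniteShaComponent_W₆ :
    haveI := isElliptic_model
    ∃ (p : ℕ) (_ : Fact p.Prime),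
      (⟨((1 : ℤ) : ℚ), ((-43669 : ℤ) : ℚ), ((-12 : ℤ) : ℚ), ((727222893 : ℤ) : ℚ), ((-4934118717095 : ℤ) : ℚ)⟩ : WeierstrassCurve ℚ).shaCorank p = 0 := by
  haveI := isElliptic_model
  haveI := isGloballyMinimal_model
  haveI : Fact (Nat.Prime 5) := ⟨Nat.prime_five⟩
  refine ⟨5, inferInstance, ?_⟩
  obtain ⟨-, -, -, hsel, hrk⟩ := KubertTateM37152EisensteinTwist.cgls_shape_37_152
  have hG := (⟨((1 : ℤ) : ℚ), ((-43669 : ℤ) : ℚ), ((-12 : ℤ) : ℚ), ((727222893 : ℤ) : ℚ), ((-4934118717095 : ℤ) : ℚ)⟩ :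
    WeierstrassCurve ℚ).selmerCorank_eq_mordellWeilRank_add_holds 5
  omega

/-- `t₅(W₆) = 0`, unconditional. [cite: SilvermanAEC2009, Thm. X.4.2] -/
theorem shaCorank_five_W₆ :
    haveI := isElliptic_model
    haveI : Fact (Nat.Prime 5) := ⟨Nat.prime_five⟩
    (⟨((1 : ℤ) : ℚ), ((-43669 : ℤ) : ℚ), ((-12 : ℤ) : ℚ), ((727222893 : ℤ) : ℚ), ((-4934118717095 : ℤ) : ℚ)⟩ : WeierstrassCurve ℚ).shaCorank 5 = 0 := by
  haveI := isElliptic_model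
  haveI := isGloballyMinimal_model
  haveI : Fact (Nat.Prime 5) := ⟨Nat.prime_five⟩
  obtain ⟨-, -, -, hsel, hrk⟩ := KubertTateM37152EisensteinTwist.cgls_shape_37_152
  have hG := (⟨((1 : ℤ) : ℚ), ((-43669 : ℤ) : ℚ), ((-12 : ℤ) : ℚ), ((727222893 : ℤ) : ℚ), ((-4934118717095 : ℤ) : ℚ)⟩ :
    WeierstrassCurve ℚ).selmerCorank_eq_mordellWeilRank_add_holds 5
  omega

/-- **T BY NAME on `W₆`**: granting `FiniteShaComponentTransfer`, every `t_q(W₆) = 0`. T itself is NOT proved (at `W₆`, a rank-`2` curve, no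
`p`-converse in print discharges it). [cite: SilvermanAEC2009, Thm. X.4.2] -/
theorem transfer_W₆ (hT : FiniteShaComponentTransfer) (q : ℕ) [Fact q.Prime] :
    haveI := isElliptic_model
    (⟨((1 : ℤ) : ℚ), ((-43669 : ℤ) : ℚ), ((-12 : ℤ) : ℚ), ((727222893 : ℤ) : ℚ), ((-4934118717095 : ℤ) : ℚ)⟩ : WeierstrassCurve ℚ).shaCorank q = 0 := by
  haveI := isElliptic_model
  obtain ⟨p, hp, h0⟩ := oneFiniteShaComponent_W₆
  exact hT _ p q h0

/-! ## §4 T is idle on this curve: X2 + X3 + Kato give `r_an = rank = 2`; X2 + GZK give `r_an = 2` -/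

/-- **`ord_{s=1} L(W₆, s) = rank W₆(ℚ)` from X2 + X3 + Kato ALONE** (no T, no O as items): the `ℚ(ζ₃)`-descent opened the admissible
door `p₀ = 5` (`t₅ = 0`, good ordinary) on this globally minimal rank-`2` curve without rational `5`-torsion.  Leg 1 at `5`: X2 gives
`r_an ≤ corank Sel_{5^∞} = rank + t₅ = rank` (Greenberg's identity, tree `selmerCorank_eq_mordellWeilRank_add_holds`); leg 2 at the prime of
X3: Kato's bound `rank ≤ ord_T L_p` and X3's `ord_T L_p ≤ r_an` (the argument of KatoTransfer's `closes` / the route's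
`analyticRank_eq_mordellWeilRank_of_admissibleDoor`, inlined to keep this file route-cone clean). CONDITIONAL on the route items `hX2`, `hX3`, `hK`.
[cite: GreenbergLNM1716, §1 (pp. 54–57)] [cite: SilvermanAEC2009, Thm. X.4.2] -/
theorem analyticRank_W₆_eq_mordellWeilRank (hX2 : AnalyticRankLeSelmerCorank)
    (hX3 : PadicOrderLeAnalyticRankAtOnePrime) (hK : KatoRankBound) :
    haveI := isElliptic_model
    (⟨((1 : ℤ) : ℚ), ((-43669 : ℤ) : ℚ), ((-12 : ℤ) : ℚ), ((727222893 : ℤ) : ℚ), ((-4934118717095 : ℤ) : ℚ)⟩ : WeierstrassCurve ℚ).analyticRank =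
      (⟨((1 : ℤ) : ℚ), ((-43669 : ℤ) : ℚ), ((-12 : ℤ) : ℚ), ((727222893 : ℤ) : ℚ), ((-4934118717095 : ℤ) : ℚ)⟩ : WeierstrassCurve ℚ).mordellWeilRank := by
  haveI := isElliptic_model
  haveI := isGloballyMinimal_model
  haveI : Fact (Nat.Prime 5) := ⟨Nat.prime_five⟩
  have ht := shaCorank_five_W₆
  obtain ⟨hgood, hord⟩ := goodOrdinary_five_W₆
  set W := (⟨((1 : ℤ) : ℚ), ((-43669 : ℤ) : ℚ), ((-12 : ℤ) : ℚ), ((727222893 : ℤ) : ℚ), ((-4934118717095 : ℤ) : ℚ)⟩ : WeierstrassCurve ℚ) with hW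
  -- leg 1 at the door prime `5`
  have hLB : W.analyticRank ≤ W.mordellWeilRank := by
    have hid : W.selmerCorank 5 = W.mordellWeilRank + W.shaCorank 5 := W.selmerCorank_eq_mordellWeilRank_add_holds 5
    have h2 := hX2 W 5 le_rfl hgood hord
    omega
  -- leg 2 at the prime of X3 (no `Ш` involved)
  have hUB : W.mordellWeilRank ≤ W.analyticRank := by
    obtain ⟨p, hp, h5p, hgoodp, hordp, N, hN, f, hf, hle⟩ := hX3 W
    have hp2 : p ≠ 2 := by omega
    have hordAt : IsOrdinaryAt W p := ⟨hgoodp, hordp⟩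
    have hk := hK W p hp2 hordAt f hf
    exact_mod_cast hk.trans hle
  exact le_antisymm hLB hUB

/-- **`ord_{s=1} L(W₆, s) = 2` from X2 + X3 + Kato alone** (rank `2` is unconditional, tree `KubertTateM37152EisensteinTwist.mordellWeilRank_model`).
CONDITIONAL on `hX2`, `hX3`, `hK`; T idle; BSD for this curve is NOT thereby proved unconditionally. [cite: GreenbergLNM1716, §1 (pp. 54–57)]
[cite: SilvermanAEC2009, Exercise 10.16] -/
theorem analyticRank_W₆_eq_two (hX2 : AnalyticRankLeSelmerCorank)
    (hX3 : PadicOrderLeAnalyticRankAtOnePrime) (hK : KatoRankBound) :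
    haveI := isElliptic_model
    (⟨((1 : ℤ) : ℚ), ((-43669 : ℤ) : ℚ), ((-12 : ℤ) : ℚ), ((727222893 : ℤ) : ℚ), ((-4934118717095 : ℤ) : ℚ)⟩ : WeierstrassCurve ℚ).analyticRank = 2 := by
  haveI := isElliptic_model
  rw [analyticRank_W₆_eq_mordellWeilRank hX2 hX3 hK]
  exact KubertTateM37152EisensteinTwist.mordellWeilRank_model

/-- **Under X2 ALONE: `ord_{s=1} L(W₆, s) ≤ 2`** (leg 1 at the admissible door `5`: `r_an ≤ s₅ = rank + t₅ = 2 + 0`).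
CONDITIONAL on `hX2` only. [cite: GreenbergLNM1716, §1 (pp. 54–57)] -/
theorem analyticRank_W₆_le_two_of_X2 (hX2 : AnalyticRankLeSelmerCorank) :
    haveI := isElliptic_model
    (⟨((1 : ℤ) : ℚ), ((-43669 : ℤ) : ℚ), ((-12 : ℤ) : ℚ), ((727222893 : ℤ) : ℚ), ((-4934118717095 : ℤ) : ℚ)⟩ : WeierstrassCurve ℚ).analyticRank ≤ 2 := by
  haveI := isElliptic_model
  haveI := isGloballyMinimal_model
  haveI : Fact (Nat.Prime 5) := ⟨Nat.prime_five⟩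
  obtain ⟨hgood, hord⟩ := goodOrdinary_five_W₆
  have h := hX2 _ 5 le_rfl hgood hord
  obtain ⟨-, -, -, hsel, -⟩ := KubertTateM37152EisensteinTwist.cgls_shape_37_152
  omega

/-- **Under X2 and Gross–Zagier–Kolyvagin: `ord_{s=1} L(W₆, s) = 2`** — rank `2` is unconditional, so GZK (the tree's named fact
`rank_eq_analyticRank_of_analyticRank_le_one`, a theorem in print) excludes `r_an ∈ {0, 1}`, and X2 at the door prime `5` caps `r_an ≤ 2`.
CONDITIONAL on `hX2` (open) and `hGZK` (in print); no X3, no Kato, no T. [cite: Darmon2004, Thm. 3.22] [cite: GreenbergLNM1716, §1 (pp. 54–57)] -/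
theorem analyticRank_W₆_eq_two_of_X2_of_GZK (hX2 : AnalyticRankLeSelmerCorank)
    (hGZK : rank_eq_analyticRank_of_analyticRank_le_one) :
    haveI := isElliptic_model
    (⟨((1 : ℤ) : ℚ), ((-43669 : ℤ) : ℚ), ((-12 : ℤ) : ℚ), ((727222893 : ℤ) : ℚ), ((-4934118717095 : ℤ) : ℚ)⟩ : WeierstrassCurve ℚ).analyticRank = 2 := by
  haveI := isElliptic_model
  refine analyticRank_eq_two_of_le_two_of_two_le_mordellWeilRank _ hGZK (analyticRank_W₆_le_two_of_X2 hX2) ?_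
  rw [KubertTateM37152EisensteinTwist.mordellWeilRank_model]

end Summit.BirchSwinnertonDyer.BirchSwinnertonDyer.Theorems.ShaPrimaryTransferEisensteinTwistDoorM37152

end
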